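import Summits.QuantumFields.YangMills.Theorems.BalabanUVNodesN07Thm313PrintedRecPrOfLetterH
import HarnessLib

/-!
# (3.153) ∕ (111) AT THE RECORD, KERNEL-CHECKED: `𝔊 = G₁𝔓* = G₁ − H₁∘(QG₁) − G₁DRD*G₁` AS OPERATORS IN THE (115) READING, and the (117) letter of `𝔊` FROM the letters of its three
# pieces — letter-generic at lit's constructed `frakGLatticeCLM`, then at def-Y's `frakGOfRecordAt` (any Hessian slot ∕ averaging pair), then row 21's framed slot-(c) display

Cell `pub-ymgap` (HUMAN RULING D-0062, Track A), node N07 [B11] ∕ the K0ᴬ port wall; seat `pub-ymgap-dag-n06-l` (g43; N06 bundle F7 = [B9] Thms 3.12∕3.13 — row 21 `t313`).  The «(S-𝔊) file 1»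
LOCATED in this seat's g43 sizing note (pub-ymgap INBOX 2026-08-31 18:09Z): the row-21 twin of ✓`…N07Thm312PrEntryRowsOfParts` — the (S) campaign's second target at the framed record
(✓`…N07Thm313PrintedRecPrOfLetterH` = the k-uniform (117) letter `Prop4LetterH (frakGprOfRecordAtBg128 …) B₀`) split into its PRINTED SOURCES.  `--kind definition` (four readings are `def`s)
`--supports stmt-QuantumFields-27238 --as helper`; count-neutral.  [B9] = [Balaban1985BackgroundPropagators]; [B11] = [Balaban1985Variational].

THE PRINTED LOCI.  [B9] (3.147) p.425 «𝔓 = I − G₁Q*(QG₁Q*)⁻¹Q − G₁DRD*», (3.153) p.426 «𝔊 = G₁𝔓* = 𝔓G₁»; [B11] p.294 «the operator G₁𝔓* is equal to the operator 𝔊» of (111), (116)–(117) p.295 «𝔊 is a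
bounded transformation from |·|₍₋₃₎ to the norm (115) … by Theorems 3.12, 3.13 of [B9]»; (103) p.293 `H₁ = G₁Q*(QG₁Q*)⁻¹`.  Hence `𝔊J = G₁J − H₁(QG₁J) − G₁DRD*G₁J` and
`‖𝔊J‖₍₁₁₅₎ ≤ ‖G₁J‖₍₁₁₅₎ + ‖H₁‖·|QG₁J|₍₋₀₎ + ‖G₁DRD*G₁J‖₍₁₁₅₎`.

WHAT IS HERE:
* §1 (lit level, data `Δ₁, R, S, Rr, Q, a`, displayed `hpos ∕ hQ`; `G₁ := G1LatticeK hpos`, `K⁻¹ := KinvLatticeK hpos hQ`): `curToBlockRead φ C` — a Hilbert-level `C : BondL2K →ₗ WL2 wB W` read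
  `|·|₍₋₃₎ →L[ℂ] |·|₍₋₀₎` (+`_apply`); ★★ `frakGLatticeCLM_eq_parts` — `frakGLatticeCLM φ hpos hQ lev₁ Dc = toCLM115 (G1Fun φ G₁) − (H1LatticeCLM φ hpos hQ lev₁ Dc) ∘ curToBlockRead φ (Q ∘ G₁) −
  toCLM115 (G1Fun φ (G₁ ∘ D ∘ Rr ∘ D* ∘ G₁))` (lit ✓`frakGLin_apply` + ✓`H1LatticeK_eq`, both unfoldings); ★★ `norm_frakGLatticeCLM_le_of_parts` — `‖G₁J‖ ≤ c₁|J|`, `|QG₁J| ≤ c₂|J|`,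
  `‖H₁B‖ ≤ b|B|` (`b ≥ 0`), `‖G₁DRD*G₁J‖ ≤ c₄|J|` ⟹ `‖𝔊J‖₍₁₁₅₎ ≤ (c₁ + bc₂ + c₄)|J|₍₋₃₎`.
* §2 (record: def-Y's ✓`frakGOfRecordAt ∕ H1OfRecordAt`, Hessian slot `Δ₁`, pair `(Q, Q′)`, `a` DATA — bare ∕ slot-(c) ∕ framed pins are instances by `rfl`): readings `g1CurReadAt` (`G₁` on currents),
  `qG1ReadAt` (`QG₁` currents → blocks), `g1LapG1ReadAt` (`G₁DRD*G₁` on currents, `R := RrOfRecord Q′`); ★★ `frakGOfRecordAt_eq_parts`; ★★★ `prop4LetterH_frakGOfRecordAt_of_parts` — the four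
  letters ⟹ `Prop4LetterH (frakGOfRecordAt … Δ₁ Q Q′ a hpos hQ) (c₁ + bc₂ + c₄)`.
* §3 ★★★ `thm313Printed_recPr_of_parts` — NODE-00, k-UNIFORM, FRAMED SLOT (c) (`Δ₁ := hessOpOfRecord128 … Gp Q′ Δ2`, `Q := Q^{pr}(U₀)`, `Q′ := QprimeOfRecord U₀`): one displayed family row carrying
  the four letters (constants before the member; the member's three `Fact`s as binders; `U₀ ∈ R35 ∩ R36`; displayed `hposπ ∕ hQ`) ⟹ the `B9.Thm313Printed c35 (geoRecGN00 F N) (bgRecN00 F N R35 R36)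
  (frakGprFamilyRecN00 F N a R35 R36 𝔥 Gp Δ2) ⊤ ⊤` antecedent the K0ᴬ consumers read (via ✓`thm313Printed_recPr_of_prop4LetterH`).
HONEST FRAMING.  What is PROVED is the operator identity (3.153)∕(111) in the (115) reading and one triangle inequality.  The four source letters — Theorem 3.3-type `‖G₁J‖₍₁₁₅₎ ≤ c₁|J|₍₋₃₎`
at the framed slot-(c) pair, the averaging bound `|Q^{pr}G₁J|₍₋₀₎ ≤ c₂|J|₍₋₃₎`, (ℓa-H) at slot (c) `Prop4LetterH (H1prOfRecordAtBg128 …) b` (= Thm 3.12 ∕ (3.133) there, cf. the row-20 twin), and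
`‖G₁DRD*G₁J‖₍₁₁₅₎ ≤ c₄|J|₍₋₃₎` ((3.124)–(3.125)) — are DISPLAYED hypotheses, NOT proved here or anywhere in the tree (XL); the displayed (117) row of record is re-sourced, NOT discharged.
`R35 ∕ R36`, `𝔥`, `Gp`, `Δ2`, `hposπ ∕ hQ` displayed; K0ᴬ ⟨stmt-QuantumFields-27238⟩ NOT closed; K0ᴬ∕K1ᴬ∕K3ᴬ 0∕3; NODE O 0∕1; COUNT 8∕28 · K 1∕4 UNMOVED; finite `𝕋⁴_{L^K}` at fixed ε — NOT continuum ∕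
ℝ⁴ ∕ OS; **the Yang–Mills mass gap (Clay) is NOT proved by any of this.**  No `sorry`, `instance`, `notation`, `set_option`; standard axioms.
-/

noncomputable section

open scoped Matrix Matrix.Norms.L2Operator InnerProductSpace ComplexConjugate BigOperators

namespace Summit.QuantumFields.YangMills.BalabanUVNodes.N07FrakGPrLetterOfParts

open Literature.MathematicalPhysics.QuantumFieldTheory.Balaban1983to89
open Literature.MathematicalPhysics.QuantumFieldTheory.Balaban1983to89.Node00
open T4Continuum (T4Family)
open B9SectCLatticeCarrier (Bond)
open B9Eq311L2Pairing (WL2)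
open B11Eq115Space (NegSup NegSize Space115 JetSup levWeight)
open B11Eq111FrakG (nabla115 toCLM115 toCLM115_apply frakG frakG_apply frakGLin_apply)
open B11Eq103H1Complex (SiteL2K BondL2K covDerivL2K covDivL2K laplaceALatticeK G1LatticeK KinvLatticeK H1LatticeK H1LatticeK_eq H1LatticeCLM H1CLM
  blockCLM115 blockCLM115_apply funEquiv readFun readFun_apply G1Fun QFun QadjFun DFun DstarFun frakGLatticeCLM)

/-! ## §1 Lit's constructed `𝔊 = G₁𝔓*` in the (115) reading SPLITS as operators: `𝔊 = G₁ − H₁ ∘ (QG₁) − G₁DRD*G₁` -/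

section Generic

variable {d : ℕ} {Pd : Fin d → ℕ} {β κ : Type*} [Fintype β] [Fintype κ] {V : Type*} [NormedAddCommGroup V] [NormedSpace ℂ V]
  [FiniteDimensional ℂ V] {W : Type*} [NormedAddCommGroup W] [InnerProductSpace ℂ W] [FiniteDimensional ℂ W] (φ : W ≃ₗ[ℂ] V)
  {L η : ℝ} [Fact (0 < L)] [Fact (0 < η)] {lev₀ : Bond d Pd → ℕ} {levB : β → ℕ} {c₀ : ℝ} [Fact (0 < c₀)] {wB : β → ℝ} [Fact (∀ y, 0 < wB y)]
  {c : ℂ} {R S : Bond d Pd → W →ₗ[ℂ] W} {Δ₁ : BondL2K ℂ d Pd c₀ W →ₗ[ℂ] BondL2K ℂ d Pd c₀ W}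
  {Rr : SiteL2K ℂ d Pd c₀ W →ₗ[ℂ] SiteL2K ℂ d Pd c₀ W} {Q : BondL2K ℂ d Pd c₀ W →ₗ[ℂ] WL2 ℂ wB W} {a : ℝ}

/-- **A HILBERT-LEVEL OPERATOR FROM THE FINE BONDS TO THE BLOCKS READ `|·|₍₋₃₎ →L[ℂ] |·|₍₋₀₎`** along the fibre map `φ` (e.g. `C := Q ∘ G₁`: the block field `QG₁J` of a current `J`;
continuity automatic on the finite lattice). [cite: Balaban1985Variational, (111) p.294, (117) p.295; Balaban1985BackgroundPropagators, (3.147) p.425] -/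
def curToBlockRead (C : BondL2K ℂ d Pd c₀ W →ₗ[ℂ] WL2 ℂ wB W) : NegSize L η lev₀ 3 V →L[ℂ] NegSize L η levB 0 V :=
  LinearMap.toContinuousLinearMap
    ((NegSup.linearEquiv ℂ (levWeight L η levB 0) : NegSize L η levB 0 V ≃ₗ[ℂ] (β → V)).symm.toLinearMap ∘ₗ
      (funEquiv φ wB).toLinearMap ∘ₗ C ∘ₗ (funEquiv φ (fun _ : Bond d Pd => c₀)).symm.toLinearMap ∘ₗ
      (NegSup.linearEquiv ℂ (levWeight L η lev₀ 3) : NegSize L η lev₀ 3 V ≃ₗ[ℂ] (Bond d Pd → V)).toLinearMap)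

omit [FiniteDimensional ℂ W] [Fact (0 < c₀)] [Fact (∀ y, 0 < wB y)] in
/-- Unfolding `curToBlockRead`. [cite: Balaban1985Variational, (111) p.294 (bookkeeping)] -/
theorem curToBlockRead_apply (C : BondL2K ℂ d Pd c₀ W →ₗ[ℂ] WL2 ℂ wB W) (f : NegSize L η lev₀ 3 V) :
    NegSup.equiv _ V (curToBlockRead (L := L) (η := η) (lev₀ := lev₀) (levB := levB) φ C f) =
      funEquiv φ wB (C ((funEquiv φ (fun _ : Bond d Pd => c₀)).symm (NegSup.equiv _ V f))) := rfl

variable (hpos : ∀ x : BondL2K ℂ d Pd c₀ W, x ≠ 0 → 0 < RCLike.re ⟪x, laplaceALatticeK c R S Δ₁ Rr Q a x⟫_ℂ) (hQ : Function.Surjective Q)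

/-- ★★ **(3.153)∕(111) AS OPERATORS IN THE (115) READING: `𝔊 = G₁ − H₁∘(QG₁) − G₁DRD*G₁`** — lit's constructed `frakGLatticeCLM φ hpos hQ` (= `frakG … (G1Fun φ G₁) (QFun φ Q) (QadjFun φ Q) K⁻¹
(DFun φ D) R (DstarFun φ D*)`, `G₁ := G1LatticeK hpos`, `K⁻¹ := KinvLatticeK hpos hQ`) equals `G₁` read on the currents, minus lit's `H1LatticeCLM φ hpos hQ` (`= G₁Q†K⁻¹` read in (115)) after
the block field `QG₁·`, minus `G₁DRD*G₁` read on the currents (`frakGLin_apply` + `H1LatticeK_eq`, both `rfl`-level).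
[cite: Balaban1985BackgroundPropagators, (3.147) p.425, (3.153) p.426; Balaban1985Variational, (103) p.293, (110)–(111) p.294] -/
theorem frakGLatticeCLM_eq_parts (lev₁ : κ → ℕ) (Dc : (Bond d Pd → V) →ₗ[ℂ] (κ → V)) :
    frakGLatticeCLM (L := L) (η := η) (lev₀ := lev₀) φ hpos hQ lev₁ Dc =
      toCLM115 lev₁ Dc (G1Fun φ (G1LatticeK hpos))
        - (H1LatticeCLM (L := L) (η := η) (lev₀ := lev₀) (levB := levB) φ hpos hQ lev₁ Dc).comp
            (curToBlockRead (L := L) (η := η) (lev₀ := lev₀) (levB := levB) φ (Q ∘ₗ G1LatticeK hpos))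
        - toCLM115 lev₁ Dc (G1Fun φ (G1LatticeK hpos ∘ₗ covDerivL2K ℂ c₀ c R ∘ₗ Rr ∘ₗ covDivL2K ℂ c₀ c S ∘ₗ G1LatticeK hpos)) := by
  refine ContinuousLinearMap.ext fun f => (JetSup.equiv _ _ Dc).injective ?_
  simp only [frakGLatticeCLM, H1LatticeCLM, H1CLM, sub_apply, ContinuousLinearMap.comp_apply, JetSup.equiv_sub, frakG_apply,
    toCLM115_apply, blockCLM115_apply, curToBlockRead_apply, frakGLin_apply, H1LatticeK_eq, G1Fun, QFun, QadjFun, DFun, DstarFun, readFun_apply,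
    LinearMap.comp_apply, LinearEquiv.coe_coe, LinearEquiv.symm_apply_apply]

/-- ★★ **THE (117) LETTER OF `𝔊` FROM THE LETTERS OF ITS THREE PIECES** (lit level): `‖G₁J‖₍₁₁₅₎ ≤ c₁|J|₍₋₃₎`, `|QG₁J|₍₋₀₎ ≤ c₂|J|₍₋₃₎`, `‖H₁B‖₍₁₁₅₎ ≤ b|B|₍₋₀₎` (`b ≥ 0`),
`‖G₁DRD*G₁J‖₍₁₁₅₎ ≤ c₄|J|₍₋₃₎` ⟹ `‖𝔊J‖₍₁₁₅₎ ≤ (c₁ + bc₂ + c₄)|J|₍₋₃₎`. [cite: Balaban1985Variational, (116)–(117) p.295, (46) p.285; Balaban1985BackgroundPropagators, Thm 3.13 p.426, (3.153) p.426] -/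
theorem norm_frakGLatticeCLM_le_of_parts (lev₁ : κ → ℕ) (Dc : (Bond d Pd → V) →ₗ[ℂ] (κ → V)) {c₁ c₂ b c₄ : ℝ} (hb : 0 ≤ b)
    (h1 : ∀ f : NegSize L η lev₀ 3 V, ‖toCLM115 lev₁ Dc (G1Fun φ (G1LatticeK hpos)) f‖ ≤ c₁ * ‖f‖)
    (h2 : ∀ f : NegSize L η lev₀ 3 V, ‖curToBlockRead (L := L) (η := η) (lev₀ := lev₀) (levB := levB) φ (Q ∘ₗ G1LatticeK hpos) f‖ ≤ c₂ * ‖f‖)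
    (h3 : ∀ B : NegSize L η levB 0 V, ‖H1LatticeCLM (L := L) (η := η) (lev₀ := lev₀) φ hpos hQ lev₁ Dc B‖ ≤ b * ‖B‖)
    (h4 : ∀ f : NegSize L η lev₀ 3 V, ‖toCLM115 lev₁ Dc (G1Fun φ (G1LatticeK hpos ∘ₗ covDerivL2K ℂ c₀ c R ∘ₗ Rr ∘ₗ covDivL2K ℂ c₀ c S ∘ₗ G1LatticeK hpos)) f‖ ≤ c₄ * ‖f‖)
    (f : NegSize L η lev₀ 3 V) :
    ‖frakGLatticeCLM (L := L) (η := η) (lev₀ := lev₀) φ hpos hQ lev₁ Dc f‖ ≤ (c₁ + b * c₂ + c₄) * ‖f‖ := by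
  have key : frakGLatticeCLM (L := L) (η := η) (lev₀ := lev₀) φ hpos hQ lev₁ Dc f =
      toCLM115 lev₁ Dc (G1Fun φ (G1LatticeK hpos)) f
        - H1LatticeCLM (L := L) (η := η) (lev₀ := lev₀) φ hpos hQ lev₁ Dc
            (curToBlockRead (L := L) (η := η) (lev₀ := lev₀) (levB := levB) φ (Q ∘ₗ G1LatticeK hpos) f)
        - toCLM115 lev₁ Dc (G1Fun φ (G1LatticeK hpos ∘ₗ covDerivL2K ℂ c₀ c R ∘ₗ Rr ∘ₗ covDivL2K ℂ c₀ c S ∘ₗ G1LatticeK hpos)) f := by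
    rw [frakGLatticeCLM_eq_parts (levB := levB) φ hpos hQ lev₁ Dc]
    rfl
  rw [key]
  have hA := h1 f
  have hB : ‖H1LatticeCLM (L := L) (η := η) (lev₀ := lev₀) φ hpos hQ lev₁ Dc
      (curToBlockRead (L := L) (η := η) (lev₀ := lev₀) (levB := levB) φ (Q ∘ₗ G1LatticeK hpos) f)‖ ≤ b * (c₂ * ‖f‖) :=
    (h3 _).trans (mul_le_mul_of_nonneg_left (h2 f) hb)
  have hC := h4 f
  refine (norm_sub_le _ _).trans ?_
  refine (add_le_add (norm_sub_le (toCLM115 lev₁ Dc (G1Fun φ (G1LatticeK hpos)) f) _) le_rfl).trans ?_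
  refine (add_le_add (add_le_add hA hB) hC).trans (le_of_eq ?_)
  ring

end Generic

/-! ## §2 At the record (Hessian slot `Δ₁`, averaging pair `(Q, Q′)`, `a` DATA — every pin of def-Y's is an instance by `rfl`): the three pieces, the split, the (117) letter from parts -/

section Record

variable (F : T4Family) (N : ℕ) (K k : ℕ) (Ω : ℕ → Set (Site (F.P K) 0)) (U₀ : GaugeField (F.P K) 0 (SU N))
  {β : Type*} [Fintype β] {wB : β → ℝ} [Fact (∀ y, 0 < wB y)] {F' : Type*} [AddCommGroup F'] [Module ℂ F']
variable [Fact (0 < (F.L : ℝ))] [Fact (0 < (F.P K).eta k)] [Fact (0 < c0Rec F K k)]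
variable (Δ₁ : BondL2K ℂ (F.P K).d (fun _ => (F.P K).sitesPerDir 0) (c0Rec F K k) (WRec N) →ₗ[ℂ] BondL2K ℂ (F.P K).d (fun _ => (F.P K).sitesPerDir 0) (c0Rec F K k) (WRec N))
  (Q : BondL2K ℂ (F.P K).d (fun _ => (F.P K).sitesPerDir 0) (c0Rec F K k) (WRec N) →ₗ[ℂ] WL2 ℂ wB (WRec N))
  (Q' : SiteL2K ℂ (F.P K).d (fun _ => (F.P K).sitesPerDir 0) (c0Rec F K k) (WRec N) →ₗ[ℂ] F') (a : ℝ)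
  (hpos : ∀ x, x ≠ 0 → 0 < RCLike.re ⟪x, laplaceAOfRecordAt F N k U₀ Δ₁ Q Q' a x⟫_ℂ)

/-- **`G₁(U₀; Δ₁) = Δ_{1,a}(U₀; Δ₁)⁻¹` READ ON THE CURRENTS**, `|·|₍₋₃₎ →L[ℂ] (115)` — the first piece of `𝔊 = G₁𝔓*`; its (117)-type letter is [B9] Theorem 3.3 ((3.42)–(3.47) for `G₁` acting on currents). A reading,
nothing asserted. [cite: Balaban1985BackgroundPropagators, Thm 3.3 (3.42)–(3.47) pp.397–398, (3.153) p.426; Balaban1985Variational, (110) p.294, (117) p.295] -/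
def g1CurReadAt : NegSizeLit F N K k Ω 3 →L[ℂ] Space115Lit F N K k Ω U₀ :=
  toCLM115 (pairLevLit F Ω k) (nabla115 ((F.P K).eta k) (unitsOfRecord F N U₀)) (G1Fun (phiRec N) (G1LatticeK hpos))

/-- **THE BLOCK FIELD `QG₁(U₀; Δ₁)J` OF A CURRENT**, `|·|₍₋₃₎ →L[ℂ] |·|₍₋₀₎` (block levels `levB`) — the argument of `H₁` in the middle piece of `𝔊`. A reading, nothing asserted.
[cite: Balaban1985BackgroundPropagators, (3.147) p.425, (3.153) p.426; Balaban1985Variational, (111) p.294] -/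
def qG1ReadAt (levB : β → ℕ) : NegSizeLit F N K k Ω 3 →L[ℂ] NegSize (F.L : ℝ) ((F.P K).eta k) levB 0 (Matrix (Fin N) (Fin N) ℂ) :=
  curToBlockRead (L := (F.L : ℝ)) (η := (F.P K).eta k) (lev₀ := bondLevLit F Ω k) (levB := levB) (phiRec N) (Q ∘ₗ G1LatticeK hpos)

/-- **`G₁DRD*G₁` READ ON THE CURRENTS**, `|·|₍₋₃₎ →L[ℂ] (115)` — the third piece of `𝔊 = G₁𝔓*` (`D` = (3.3), `D*` = (3.8) with the record's transporters, `R = RrOfRecord Q′` = (3.21)); its letter is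
[B9] (3.124)–(3.125) ∕ (3.45)-type. A reading, nothing asserted. [cite: Balaban1985BackgroundPropagators, (3.21) p.394, (3.124) p.420, (3.153) p.426; Balaban1985Variational, (110)–(111) p.294] -/
def g1LapG1ReadAt : NegSizeLit F N K k Ω 3 →L[ℂ] Space115Lit F N K k Ω U₀ :=
  toCLM115 (pairLevLit F Ω k) (nabla115 ((F.P K).eta k) (unitsOfRecord F N U₀))
    (G1Fun (phiRec N) (G1LatticeK hpos ∘ₗ covDerivL2K ℂ (c0Rec F K k) (cRec F K k) (RRec F N U₀) ∘ₗ RrOfRecord F N k U₀ Q' ∘ₗ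
      covDivL2K ℂ (c0Rec F K k) (cRec F K k) (SRec F N U₀) ∘ₗ G1LatticeK hpos))

/-- ★★ **`𝔊(U₀; Δ₁) = G₁ − H₁(U₀; Δ₁) ∘ (QG₁) − G₁DRD*G₁` AT THE RECORD, AS OPERATORS** (def-Y's `frakGOfRecordAt` ∕ `H1OfRecordAt`; every pin — bare `frakGOfRecord`, slot (c)
`frakG(pr)OfRecordAtBg128`, framed or frame-free `Q` — is an instance by `rfl`). [cite: Balaban1985BackgroundPropagators, (3.153) p.426; Balaban1985Variational, (103) p.293, (110)–(111) p.294] -/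
theorem frakGOfRecordAt_eq_parts (levB : β → ℕ) (hQ : Function.Surjective Q) :
    frakGOfRecordAt F N K k Ω U₀ Δ₁ Q Q' a hpos hQ =
      g1CurReadAt F N K k Ω U₀ Δ₁ Q Q' a hpos - (H1OfRecordAt F N K k Ω U₀ levB Δ₁ Q Q' a hpos hQ).comp (qG1ReadAt F N K k Ω U₀ Δ₁ Q Q' a hpos levB)
        - g1LapG1ReadAt F N K k Ω U₀ Δ₁ Q Q' a hpos :=
  frakGLatticeCLM_eq_parts (levB := levB) (phiRec N) hpos hQ (pairLevLit F Ω k) (nabla115 ((F.P K).eta k) (unitsOfRecord F N U₀))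

/-- ★★★ **THE (117) LETTER OF `𝔊(U₀; Δ₁)` FROM THE LETTERS OF ITS PIECES, AT THE RECORD**: `‖G₁J‖₍₁₁₅₎ ≤ c₁|J|₍₋₃₎` (Thm 3.3-type), `|QG₁J|₍₋₀₎ ≤ c₂|J|₍₋₃₎`, (ℓa-H) `Prop4LetterH (H₁(U₀; Δ₁)) b`
(`b ≥ 0`), `‖G₁DRD*G₁J‖₍₁₁₅₎ ≤ c₄|J|₍₋₃₎` ⟹ `Prop4LetterH (𝔊(U₀; Δ₁)) (c₁ + bc₂ + c₄)` — print's «(117) by Theorems 3.12–3.13 of [B9]» with the triangle inequality made explicit.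
[cite: Balaban1985Variational, (116)–(117) p.295, (46) p.285; Balaban1985BackgroundPropagators, Thm 3.13 p.426, Thm 3.3 p.397, (3.124) p.420, (3.133) p.422] -/
theorem prop4LetterH_frakGOfRecordAt_of_parts (levB : β → ℕ) (hQ : Function.Surjective Q) {c₁ c₂ b c₄ : ℝ} (hb : 0 ≤ b)
    (h1 : ∀ f, ‖g1CurReadAt F N K k Ω U₀ Δ₁ Q Q' a hpos f‖ ≤ c₁ * ‖f‖)
    (h2 : ∀ f, ‖qG1ReadAt F N K k Ω U₀ Δ₁ Q Q' a hpos levB f‖ ≤ c₂ * ‖f‖)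
    (h3 : Prop4LetterH (H1OfRecordAt F N K k Ω U₀ levB Δ₁ Q Q' a hpos hQ) b)
    (h4 : ∀ f, ‖g1LapG1ReadAt F N K k Ω U₀ Δ₁ Q Q' a hpos f‖ ≤ c₄ * ‖f‖) :
    Prop4LetterH (frakGOfRecordAt F N K k Ω U₀ Δ₁ Q Q' a hpos hQ) (c₁ + b * c₂ + c₄) :=
  fun f => norm_frakGLatticeCLM_le_of_parts (levB := levB) (phiRec N) hpos hQ (pairLevLit F Ω k) (nabla115 ((F.P K).eta k) (unitsOfRecord F N U₀))
    hb h1 h2 h3 h4 f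

end Record

/-! ## §3 Node-00, k-uniform, framed slot (c): row 21's displayed `B9.Thm313Printed … (frakGprFamilyRecN00 …)` antecedent from the four primitive letters -/

section Family

open Summit.QuantumFields.YangMills.BalabanUVNodes.N07Prop4LetterHOfThm312 (MemberN00 bgRecN00)
open Summit.QuantumFields.YangMills.BalabanUVNodes.N07FrakGLetterOfThm313 (geoRecGN00)
open Summit.QuantumFields.YangMills.BalabanUVNodes.N07FramedLettersOfThm312313 (frakGprFamilyRecN00)
open Summit.QuantumFields.YangMills.BalabanUVNodes.N07Thm313PrintedRecPrOfLetterH (thm313Printed_recPr_of_prop4LetterH)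

variable (F : T4Family) (N : ℕ) [NeZero N] (a : ℝ)

/-- ★★★ **ROW 21'S DISPLAYED ANTECEDENT FROM THE FOUR PRIMITIVE LETTERS (node-00, k-uniform, framed slot (c))** — the `B9.Thm313Printed c35 (geoRecGN00 F N) (bgRecN00 F N R35 R36)
(frakGprFamilyRecN00 F N a R35 R36 𝔥 Gp Δ2) ⊤ ⊤` display read by dag-n07-e's ✓`frakGprLetterAtRecord_of_thm313Printed` and PT-B's Prop. 4 door files FOLLOWS from ONE k-uniform row with constants bound BEFORE
the member: at every member `i` (`M₄ ≤ Mc_i`), `0 < α₀` (`Mc_i·α₀ ≤ a₀`), the member's three positivity `Fact`s as binders, admissible `U₀ ∈ R35 ∩ R36 (i c35 α₀)` and displayed `hposπ ∕ hQ` of the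
framed slot-(c) pair (`Δ₁ := hessOpOfRecord128 … (Gp i U₀) (Q′(U₀)) (Δ2 i U₀)`, `Q := Q^{pr}(U₀)`, `Q′ := QprimeOfRecord U₀`): (G) `‖G₁J‖₍₁₁₅₎ ≤ c₁|J|₍₋₃₎` (Theorem 3.3-type, `G₁` on currents),
(QG) `|Q^{pr}G₁J|₍₋₀₎ ≤ c₂|J|₍₋₃₎`, (ℓa-H)₍c₎ `Prop4LetterH (H1prOfRecordAtBg128 …) b`, (L) `‖G₁DRD*G₁J‖₍₁₁₅₎ ≤ c₄|J|₍₋₃₎`; then §2 gives the (117) letter `Prop4LetterH (𝔊^{pr}(U₀)) (c₁ + bc₂ + c₄)` and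
✓`thm313Printed_recPr_of_prop4LetterH` the display.  The four letters are NOT proved here (XL: [B9] Thm 3.3 for `G₁` at the framed slot-(c) pair; the averaging bound; Thm 3.12 ∕ (3.133) at slot (c);
(3.124)–(3.125)); they replace the single displayed (117) row of record by its printed sources.
[cite: Balaban1985BackgroundPropagators, Thm 3.13 p.426, (3.147) p.425, (3.153) p.426, Thm 3.3 (3.42)–(3.47) pp.397–398, (3.124) p.420, (3.128) p.421; Balaban1985Variational, (110)–(111) p.294, (116)–(117) p.295] -/
theorem thm313Printed_recPr_of_parts [Fact (0 < (F.L : ℝ))] {c35 : ℝ}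
    {R35 R36 : ∀ i : MemberN00 F, ℝ → ℝ → GaugeField (F.P i.K) 0 (SU N) → Prop}
    {𝔥 : ∀ i : MemberN00 F, (U₀ : GaugeField (F.P i.K) 0 (SU N)) → FrameDatum (F.P i.K) N i.k U₀}
    {Gp : ∀ i : MemberN00 F, GaugeField (F.P i.K) 0 (SU N) →
      (SiteL2K ℂ (F.P i.K).d (fun _ => (F.P i.K).sitesPerDir 0) (c0Rec F i.K i.k) (WRec N) →ₗ[ℂ]
        SiteL2K ℂ (F.P i.K).d (fun _ => (F.P i.K).sitesPerDir 0) (c0Rec F i.K i.k) (WRec N))}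
    {Δ2 : ∀ i : MemberN00 F, GaugeField (F.P i.K) 0 (SU N) →
      (BondL2K ℂ (F.P i.K).d (fun _ => (F.P i.K).sitesPerDir 0) (c0Rec F i.K i.k) (WRec N) →ₗ[ℂ]
        BondL2K ℂ (F.P i.K).d (fun _ => (F.P i.K).sitesPerDir 0) (c0Rec F i.K i.k) (WRec N))}
    (h : ∃ M₄ a₀ c₁ c₂ b c₄ : ℝ, 0 < M₄ ∧ 0 < a₀ ∧ 0 < c₁ ∧ 0 ≤ c₂ ∧ 0 ≤ b ∧ 0 ≤ c₄ ∧
      ∀ i : MemberN00 F, M₄ ≤ (i.Mc : ℝ) → ∀ α₀ : ℝ, 0 < α₀ → (i.Mc : ℝ) * α₀ ≤ a₀ →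
        ∀ [Fact (0 < (F.P i.K).eta i.k)] [Fact (0 < c0Rec F i.K i.k)] [Fact (∀ c, 0 < wBRec F i.K i.k c)],
        ∀ U₀ : GaugeField (F.P i.K) 0 (SU N), R35 i c35 α₀ U₀ → R36 i c35 α₀ U₀ →
          ∀ (hposπ : ∀ x, x ≠ 0 → 0 < RCLike.re ⟪x, laplaceAOfRecordAt F N i.k U₀ (hessOpOfRecord128 F N i.k U₀ (Gp i U₀) (QprimeOfRecord F N i.k U₀) (Δ2 i U₀))
              (QprOfRecord F N i.k U₀ (𝔥 i U₀)) (QprimeOfRecord F N i.k U₀) a x⟫_ℂ)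
            (hQ : Function.Surjective (QprOfRecord F N i.k U₀ (𝔥 i U₀))),
            (∀ f, ‖g1CurReadAt F N i.K i.k i.Ω U₀ (hessOpOfRecord128 F N i.k U₀ (Gp i U₀) (QprimeOfRecord F N i.k U₀) (Δ2 i U₀))
                (QprOfRecord F N i.k U₀ (𝔥 i U₀)) (QprimeOfRecord F N i.k U₀) a hposπ f‖ ≤ c₁ * ‖f‖) ∧
            (∀ f, ‖qG1ReadAt F N i.K i.k i.Ω U₀ (hessOpOfRecord128 F N i.k U₀ (Gp i U₀) (QprimeOfRecord F N i.k U₀) (Δ2 i U₀))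
                (QprOfRecord F N i.k U₀ (𝔥 i U₀)) (QprimeOfRecord F N i.k U₀) a hposπ i.levB f‖ ≤ c₂ * ‖f‖) ∧
            Prop4LetterH (H1prOfRecordAtBg128 F N i.K i.k i.Ω U₀ (𝔥 i U₀) i.levB (Gp i U₀) (Δ2 i U₀) a hposπ hQ) b ∧
            (∀ f, ‖g1LapG1ReadAt F N i.K i.k i.Ω U₀ (hessOpOfRecord128 F N i.k U₀ (Gp i U₀) (QprimeOfRecord F N i.k U₀) (Δ2 i U₀))
                (QprOfRecord F N i.k U₀ (𝔥 i U₀)) (QprimeOfRecord F N i.k U₀) a hposπ f‖ ≤ c₄ * ‖f‖)) :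
    B9.Thm313Printed c35 (geoRecGN00 F N) (bgRecN00 F N R35 R36) (frakGprFamilyRecN00 F N a R35 R36 𝔥 Gp Δ2)
      (fun _ _ _ _ => True) (fun _ _ _ => True) := by
  obtain ⟨M₄, a₀, c₁, c₂, b, c₄, hM₄, ha₀, hc₁, hc₂, hb, hc₄, h⟩ := h
  have hB₀ : 0 < c₁ + b * c₂ + c₄ := by nlinarith [mul_nonneg hb hc₂]
  refine thm313Printed_recPr_of_prop4LetterH F N a ⟨M₄, a₀, c₁ + b * c₂ + c₄, hM₄, ha₀, hB₀, fun i hM α₀ hα₀ hMa => ?_⟩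
  intro _ _ _ U₀ h35 h36 hposπ hQ
  obtain ⟨h1, h2, h3, h4⟩ := h i hM α₀ hα₀ hMa U₀ h35 h36 hposπ hQ
  exact prop4LetterH_frakGOfRecordAt_of_parts F N i.K i.k i.Ω U₀ _ _ _ a hposπ i.levB hQ hb h1 h2 h3 h4

end Family

end Summit.QuantumFields.YangMills.BalabanUVNodes.N07FrakGPrLetterOfParts

end
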